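import Summits.ResolutionOfSingularities.ResolutionOfSingularities.Theorems.EquisingularLiftEquisingularLiftNatDSeriesCharts
import HarnessLib

/-!
# [OURS] THE `D_{2m+4}` NORMAL FORMS `y₀²y₁ + y₀y₁^{m+2} + y₂²` HAVE BLOW-UP DEPTH `m + 1` IN EVERY BLOW-UP TOWER — every field, every characteristic
# (cruxes `Theses.EquisingularLift.EquisingularLiftNat` / `…NatThree` / `EquisingularLift`, stmt-ResolutionOfSingularities-20038 / -20148 / -15660)

[OURS · leafhand-res-equisingularlift-12 g1, 2026-09-01; cell `pub/decomp-res`] AI-produced, weaker than expert review; NOT a statement of any manuscript;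
nothing here proves resolution of singularities in positive characteristic.  DEF-FREE helper; no `sorry`; standard axioms; ZERO named hypotheses.

leafhand-12 g0 certified the whole `A`-series (`y₀y₁ + y₂^{n+1}`) through the all-levels marked engine ✓ `OneStep.towerLevel_succ_origin_marked`.  This file
runs the EVEN `D`-SERIES through the same engine, in EXACT trinomial arithmetic (no square roots, no restriction on the characteristic): with the double
plane `y₂²` as tangent cone and the binary cubic `y₀y₁(y₀ + y₁)` (three RATIONAL tangent directions `0, ∞, -1`),

  `f_m = y₀²y₁ + y₀y₁^{m+2} + y₂²`  (`f_0 = y₂² + y₀y₁(y₀+y₁)` is `D₄`, `f_m` is `D_{2m+4} = x² + yz(y + z^{m+1})`),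

chart `1` of the blow-up of the origin carries `f_{m-1}` LITERALLY at its origin (`f_m(T₁T₀, T₁, T₁T₂) = T₁²·f_{m-1}(T)`), chart `0` carries the node
`T₀T₁ + T₂² + T₀^{m+1}T₁^{m+2}`, chart `2` is empty over the origin; for `D₄` itself charts `0` and `1` each carry TWO nodes, at the origin and at the
rational mark `-1`.

Bricks (charts, Jacobian analysis, marks, node one-step data): ✓ `…NatDSeriesCharts`.

* ★★ `OneStep.towerLevel_origin_D₄` — `D₄ = y₀²y₁ + y₀y₁² + y₂²` has `D`-level `1`: four nodes over the origin (two per chart, at `0` and `-1`);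
* ★★★ `OneStep.towerLevel_origin_D_even` — by induction on `m`: for every `f = y₀²y₁ + y₀y₁^{m+2} + y₂²` the origin of `Spec K[y]/(f)` has `D`-level
  `m + 1`, for every blow-up tower `D` (✓ `towerLevel_succ_origin_marked`, ✓ `towerLevel_zero_origin`).

NOT included (honest): the vertex / `IsoHypPoint` corollaries in the style of ✓ `isoHypPoint_of_A_oddVertices` — for an exact trinomial vertex chart of
degree `≥ 4` the homogenisation is singular along the line at infinity `{x₂ = x₃ = 0}`, so their `hoff` hypothesis is unsatisfiable; the local level
statement is the content.  Closes no registered stub.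

References: [Hartshorne1977, I Thm. 5.1, I Ex. 5.6, II Ex. 7.12]; [Lipman1969, §24 (absolutely isolated double points)]; [StacksProject, Tags 0804, 080E];
through the cited tree files.
-/

set_option linter.dupNamespace false -- mandated namespace `Summit.<Summit>.<Problem>` of this single-conjunct summit

noncomputable section

open CategoryTheory CategoryTheory.Limits AlgebraicGeometry TopologicalSpace Topology
open MvPolynomial
open Literature.AlgebraicGeometry.Resolution
open AlgebraicGeometry.Scheme.IdealSheafData

namespace Summit.ResolutionOfSingularities.ResolutionOfSingularities.Cruxes.EquisingularLiftNat.Sections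

namespace OneStep

variable (K : Type) [Field K]

/-- ★★ **`D₄ = y₀²y₁ + y₀y₁² + y₂²` HAS LEVEL `1` IN EVERY BLOW-UP TOWER** (every field, every characteristic): charts `0` and `1` each carry two
nodes over the origin, at the origin and at the rational mark `-1`; chart `2` is empty. [OURS] [cite: Hartshorne1977, I Thm. 5.1, I Ex. 5.6]
[cite: StacksProject, Tags 0804, 080E] -/
theorem towerLevel_origin_D₄ (D : ℕ → ∀ Γ : Scheme.{0}, Γ → Prop)
    (hD0 : ∀ (Γ : Scheme.{0}) (y : Γ), IsClosed (({y} : Set Γ)) →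
      (D 0 Γ y ↔ ∀ (hy : IsClosed (({y} : Set Γ))) (Z : Scheme.{0}) (τ : Z ⟶ Γ), IsBlowup τ (vanishingIdeal ⟨{y}, hy⟩) →
        ∀ z : Z, τ z = y → IsRegularLocalRing (Z.presheaf.stalk z)))
    (hDsucc : ∀ (d : ℕ) (Γ : Scheme.{0}) (y : Γ), IsClosed (({y} : Set Γ)) →
      (D (d + 1) Γ y ↔ ∀ (hy : IsClosed (({y} : Set Γ))) (Z : Scheme.{0}) (τ : Z ⟶ Γ), IsBlowup τ (vanishingIdeal ⟨{y}, hy⟩) →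
        ∃ S' : Finset Z, (∀ z : Z, τ z = y → z ∉ S' → IsRegularLocalRing (Z.presheaf.stalk z)) ∧
          ∀ z ∈ S', τ z = y ∧ IsClosed (({z} : Set Z)) ∧ ∃ d' ≤ d, D d' Z z)) :
    ∀ (f : MvPolynomial (Fin 3) K), f = X 0 ^ 2 * X 1 + X 0 * X 1 ^ 2 + X 2 ^ 2 →
      ∀ (y₀ : Spec (CommRingCat.of (MvPolynomial (Fin 3) K ⧸ Ideal.span {f}))),
        y₀.asIdeal = Ideal.map (Ideal.Quotient.mk (Ideal.span {f})) (Ideal.span (Set.range (X : Fin 3 → MvPolynomial (Fin 3) K))) →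
        D 1 (Spec (CommRingCat.of (MvPolynomial (Fin 3) K ⧸ Ideal.span {f}))) y₀ := by
  classical
  have hΦ : (X 2 ^ 2 : MvPolynomial (Fin 3) K).IsHomogeneous 2 := isHomogeneous_X_pow (2 : Fin 3) 2
  have hΦ0 : (X 2 ^ 2 : MvPolynomial (Fin 3) K) ≠ 0 := pow_ne_zero _ (X_ne_zero 2)
  intro f hf y₀ hy₀
  have e : (X 2 ^ 2 : MvPolynomial (Fin 3) K) + (X 0 ^ 2 * X 1 + X 0 * X 1 ^ (0 + 2)) = f := by rw [hf]; ring
  subst e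
  have hΨ := SecondOrderPoint.D_even_tail_mem_pow K 0
  obtain ⟨G₂, hG₂, hJ₂⟩ := SecondOrderPoint.sq_chart_vacuous₂ K hΨ
  have hG₀ := SecondOrderPoint.D_even_strictTransform₀ K 0
  have hG₁ := SecondOrderPoint.D₄'_strictTransform₁ K
  -- the level-0 payload of a translate `(c·T₀T₁ + T₂²) + (Ψ₁ + 0)`
  have hpay : ∀ (c : K), c ≠ 0 → ∀ Ψ₁ : MvPolynomial (Fin 3) K, Ψ₁.IsHomogeneous 3 →
      ∀ y' : Spec (CommRingCat.of (MvPolynomial (Fin 3) K ⧸ Ideal.span {(C c * (X 0 * X 1) + X 2 ^ 2) + (Ψ₁ + 0)})),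
        y'.asIdeal = Ideal.map (Ideal.Quotient.mk (Ideal.span {(C c * (X 0 * X 1) + X 2 ^ 2) + (Ψ₁ + 0)}))
          (Ideal.span (Set.range (X : Fin 3 → MvPolynomial (Fin 3) K))) →
        ∃ d' ≤ 0, D d' (Spec (CommRingCat.of (MvPolynomial (Fin 3) K ⧸ Ideal.span {(C c * (X 0 * X 1) + X 2 ^ 2) + (Ψ₁ + 0)}))) y' := by
    intro c hc Ψ₁ hΨ₁ y' hy'
    refine ⟨0, le_rfl, towerLevel_zero_origin K D hD0 hDsucc (C c * (X 0 * X 1) + X 2 ^ 2) (Ψ₁ + 0) (by norm_num)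
      (SecondOrderPoint.node_cone_C K c).1 (SecondOrderPoint.node_cone_C K c).2
      (FirstOrderPoint.add_mem_pow_succ K hΨ₁ (Ideal.zero_mem _))
      (fun b => SecondOrderPoint.node_oneStep_C K hc Ψ₁ 0 hΨ₁ (Ideal.zero_mem _) b) y' hy'⟩
  have hc1 : (-1 : K) ≠ 0 := neg_ne_zero.mpr one_ne_zero
  have hΨ₁₀ : (X 0 * X 1 ^ 2 : MvPolynomial (Fin 3) K).IsHomogeneous 3 := by
    simpa using (isHomogeneous_X K (0 : Fin 3)).mul (isHomogeneous_X_pow (1 : Fin 3) 2)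
  have hΨ₁₁ : (X 0 ^ 2 * X 1 : MvPolynomial (Fin 3) K).IsHomogeneous 3 := by
    simpa using (isHomogeneous_X_pow (0 : Fin 3) 2).mul (isHomogeneous_X K (1 : Fin 3))
  have htr₀ : aeval (fun i : Fin 3 => X i + C ((0 : Fin 3 → K) i)) (X 0 * X 1 + X 2 ^ 2 + X 0 * (X 0 ^ 0 * X 1 ^ (0 + 2)) : MvPolynomial (Fin 3) K) =
      (C (1 : K) * (X 0 * X 1) + X 2 ^ 2) + (X 0 * X 1 ^ 2 + 0) := by
    rw [SecondOrderPoint.aeval_translate_zero, map_one]; ring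
  have htr₁ : aeval (fun i : Fin 3 => X i + C ((0 : Fin 3 → K) i)) (X 0 * X 1 + X 2 ^ 2 + X 1 * (X 1 ^ 0 * X 0 ^ (0 + 2)) : MvPolynomial (Fin 3) K) =
      (C (1 : K) * (X 0 * X 1) + X 2 ^ 2) + (X 0 ^ 2 * X 1 + 0) := by
    rw [SecondOrderPoint.aeval_translate_zero, map_one]; ring
  refine towerLevel_succ_origin_marked K D hD0 hDsucc 0 (X 2 ^ 2) (X 0 ^ 2 * X 1 + X 0 * X 1 ^ (0 + 2)) (by norm_num) hΦ hΦ0 hΨ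
    ![X 0 * X 1 + X 2 ^ 2 + X 0 * (X 0 ^ 0 * X 1 ^ (0 + 2)), X 0 * X 1 + X 2 ^ 2 + X 1 * (X 1 ^ 0 * X 0 ^ (0 + 2)), G₂] (fun a => ?_)
    ![{(0 : Fin 3 → K), -(Pi.single (1 : Fin 3) (1 : K))}, {(0 : Fin 3 → K), -(Pi.single (0 : Fin 3) (1 : K))}, ∅]
    (fun a P hP haP hGP => ?_) (fun a lam hlam _ => ?_) y₀ hy₀
  · fin_cases a
    · exact hG₀
    · exact hG₁
    · exact hG₂
  · fin_cases a
    · by_cases hall : ∀ j, pderiv j (X 0 * X 1 + X 2 ^ 2 + X 0 * (X 0 ^ 0 * X 1 ^ (0 + 2)) : MvPolynomial (Fin 3) K) ∈ P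
      · right
        obtain ⟨h2, hj⟩ := SecondOrderPoint.D_even_jac₀ K 0 P hP haP hGP hall
        rcases SecondOrderPoint.D₄'_marks K P hP (l := 0) (j := 1) (by decide) (by decide) (by decide) haP h2 hj with h | h
        · refine ⟨0, ?_, ?_⟩
          · exact Finset.mem_insert_self _ _
          · exact h
        · refine ⟨-(Pi.single (1 : Fin 3) (1 : K)), ?_, ?_⟩
          · exact Finset.mem_insert_of_mem (Finset.mem_singleton_self _)
          · exact h
      · left
        push Not at hall
        exact hall
    · by_cases hall : ∀ j, pderiv j (X 0 * X 1 + X 2 ^ 2 + X 1 * (X 1 ^ 0 * X 0 ^ (0 + 2)) : MvPolynomial (Fin 3) K) ∈ P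
      · right
        obtain ⟨h2, hj⟩ := SecondOrderPoint.D₄'_jac₁ K P hP haP hGP hall
        rcases SecondOrderPoint.D₄'_marks K P hP (l := 1) (j := 0) (by decide) (by decide) (by decide) haP h2 hj with h | h
        · refine ⟨0, ?_, ?_⟩
          · exact Finset.mem_insert_self _ _
          · exact h
        · refine ⟨-(Pi.single (0 : Fin 3) (1 : K)), ?_, ?_⟩
          · exact Finset.mem_insert_of_mem (Finset.mem_singleton_self _)
          · exact h
      · left
        push Not at hall
        exact hall
    · exact (hJ₂ P hP haP hGP).elim
  · fin_cases a
    · -- chart 0: marks `0` and `(0,-1,0)`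
      simp only [Fin.zero_eta, Matrix.cons_val_zero, Finset.mem_insert, Finset.mem_singleton] at hlam
      rcases hlam with rfl | rfl
      · exact ⟨2, C (1 : K) * (X 0 * X 1) + X 2 ^ 2, X 0 * X 1 ^ 2 + 0, by norm_num, (SecondOrderPoint.node_cone_C K 1).1,
          FirstOrderPoint.add_mem_pow_succ K hΨ₁₀ (Ideal.zero_mem _), htr₀, hpay 1 one_ne_zero _ hΨ₁₀⟩
      · refine ⟨2, C (-1 : K) * (X 0 * X 1) + X 2 ^ 2, X 0 * X 1 ^ 2 + 0, by norm_num, (SecondOrderPoint.node_cone_C K (-1)).1,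
          FirstOrderPoint.add_mem_pow_succ K hΨ₁₀ (Ideal.zero_mem _), ?_, hpay (-1) hc1 _ hΨ₁₀⟩
        exact SecondOrderPoint.D₄'_translate₀ K
    · -- chart 1: marks `0` and `(-1,0,0)`
      simp only [Fin.mk_one, Matrix.cons_val_one, Matrix.cons_val_zero, Finset.mem_insert, Finset.mem_singleton] at hlam
      rcases hlam with rfl | rfl
      · exact ⟨2, C (1 : K) * (X 0 * X 1) + X 2 ^ 2, X 0 ^ 2 * X 1 + 0, by norm_num, (SecondOrderPoint.node_cone_C K 1).1,
          FirstOrderPoint.add_mem_pow_succ K hΨ₁₁ (Ideal.zero_mem _), htr₁, hpay 1 one_ne_zero _ hΨ₁₁⟩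
      · refine ⟨2, C (-1 : K) * (X 0 * X 1) + X 2 ^ 2, X 0 ^ 2 * X 1 + 0, by norm_num, (SecondOrderPoint.node_cone_C K (-1)).1,
          FirstOrderPoint.add_mem_pow_succ K hΨ₁₁ (Ideal.zero_mem _), ?_, hpay (-1) hc1 _ hΨ₁₁⟩
        exact SecondOrderPoint.D₄'_translate₁ K
    · exact absurd hlam (Finset.notMem_empty _)

/-- ★★★ **`D_{2m+4}` HAS LEVEL `m + 1` IN EVERY BLOW-UP TOWER** (every field, every characteristic): for every `m` and every
`f = y₀²y₁ + y₀y₁^{m+2} + y₂²`, the origin of `Spec K[y]/(f)` has `D`-level `m + 1`. [OURS] [cite: Hartshorne1977, I Thm. 5.1, I Ex. 5.6] [cite: Lipman1969, §24]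
[cite: StacksProject, Tag 080E] -/
theorem towerLevel_origin_D_even (D : ℕ → ∀ Γ : Scheme.{0}, Γ → Prop)
    (hD0 : ∀ (Γ : Scheme.{0}) (y : Γ), IsClosed (({y} : Set Γ)) →
      (D 0 Γ y ↔ ∀ (hy : IsClosed (({y} : Set Γ))) (Z : Scheme.{0}) (τ : Z ⟶ Γ), IsBlowup τ (vanishingIdeal ⟨{y}, hy⟩) →
        ∀ z : Z, τ z = y → IsRegularLocalRing (Z.presheaf.stalk z)))
    (hDsucc : ∀ (d : ℕ) (Γ : Scheme.{0}) (y : Γ), IsClosed (({y} : Set Γ)) →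
      (D (d + 1) Γ y ↔ ∀ (hy : IsClosed (({y} : Set Γ))) (Z : Scheme.{0}) (τ : Z ⟶ Γ), IsBlowup τ (vanishingIdeal ⟨{y}, hy⟩) →
        ∃ S' : Finset Z, (∀ z : Z, τ z = y → z ∉ S' → IsRegularLocalRing (Z.presheaf.stalk z)) ∧
          ∀ z ∈ S', τ z = y ∧ IsClosed (({z} : Set Z)) ∧ ∃ d' ≤ d, D d' Z z)) (m : ℕ) :
    ∀ (f : MvPolynomial (Fin 3) K), f = X 0 ^ 2 * X 1 + X 0 * X 1 ^ (m + 2) + X 2 ^ 2 →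
      ∀ (y₀ : Spec (CommRingCat.of (MvPolynomial (Fin 3) K ⧸ Ideal.span {f}))),
        y₀.asIdeal = Ideal.map (Ideal.Quotient.mk (Ideal.span {f})) (Ideal.span (Set.range (X : Fin 3 → MvPolynomial (Fin 3) K))) →
        D (m + 1) (Spec (CommRingCat.of (MvPolynomial (Fin 3) K ⧸ Ideal.span {f}))) y₀ := by
  classical
  have hΦ : (X 2 ^ 2 : MvPolynomial (Fin 3) K).IsHomogeneous 2 := isHomogeneous_X_pow (2 : Fin 3) 2
  have hΦ0 : (X 2 ^ 2 : MvPolynomial (Fin 3) K) ≠ 0 := pow_ne_zero _ (X_ne_zero 2)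
  have hnode : (X 0 * X 1 + X 2 ^ 2 : MvPolynomial (Fin 3) K).IsHomogeneous 2 := by
    refine IsHomogeneous.add ?_ (isHomogeneous_X_pow 2 2)
    simpa using (isHomogeneous_X K (0 : Fin 3)).mul (isHomogeneous_X K (1 : Fin 3))
  have hnode0 : (X 0 * X 1 + X 2 ^ 2 : MvPolynomial (Fin 3) K) ≠ 0 := by
    intro h
    have h1 := congrArg (eval (Pi.single (2 : Fin 3) (1 : K))) h
    simp at h1
  -- node one-step data with tangent cone `T₀T₁ + T₂²` (coefficient `1`) and any tail
  have hnode1 : ∀ (Ψ₁ Ψ'' : MvPolynomial (Fin 3) K), Ψ₁.IsHomogeneous 3 →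
      Ψ'' ∈ Ideal.span (Set.range (X : Fin 3 → MvPolynomial (Fin 3) K)) ^ 4 → ∀ b : Fin 3, ∃ G' : MvPolynomial (Fin 3) K,
      aeval (fun j => X b * Function.update (X : Fin 3 → MvPolynomial (Fin 3) K) b 1 j) ((X 0 * X 1 + X 2 ^ 2) + (Ψ₁ + Ψ'')) = X b ^ 2 * G' ∧
      ∀ P : Ideal (MvPolynomial (Fin 3) K), P.IsPrime → (X b : MvPolynomial (Fin 3) K) ∈ P → G' ∈ P → ∃ j, pderiv j G' ∉ P :=
    fun Ψ₁ Ψ'' hΨ₁ hΨ'' b => FirstOrderPoint.exists_strictTransform K (X 0 * X 1 + X 2 ^ 2) Ψ₁ Ψ'' hnode hΨ₁ hΨ''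
      (fun P hP hΦP hdP hΨP => FirstOrderPoint.firstOrder_node K Ψ₁ P hP hΦP hdP hΨP) b
  induction m with
  | zero =>
    intro f hf y₀ hy₀
    exact towerLevel_origin_D₄ K D hD0 hDsucc f (hf.trans (by ring)) y₀ hy₀
  | succ m ih =>
    intro f hf y₀ hy₀
    have e : (X 2 ^ 2 : MvPolynomial (Fin 3) K) + (X 0 ^ 2 * X 1 + X 0 * X 1 ^ (m + 3)) = f := by rw [hf]; ring
    subst e
    have hΨ : (X 0 ^ 2 * X 1 + X 0 * X 1 ^ (m + 3) : MvPolynomial (Fin 3) K) ∈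
        Ideal.span (Set.range (X : Fin 3 → MvPolynomial (Fin 3) K)) ^ (2 + 1) := SecondOrderPoint.D_even_tail_mem_pow K (m + 1)
    obtain ⟨G₂, hG₂, hJ₂⟩ := SecondOrderPoint.sq_chart_vacuous₂ K hΨ
    have hG₀ := SecondOrderPoint.D_even_strictTransform₀ K (m + 1)
    have hG₁ := SecondOrderPoint.D_even_strictTransform₁ K m
    have htail₀ : (X 0 * (X 0 ^ (m + 1) * X 1 ^ (m + 1 + 2)) : MvPolynomial (Fin 3) K) ∈
        Ideal.span (Set.range (X : Fin 3 → MvPolynomial (Fin 3) K)) ^ 4 := by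
      have e : (X 0 * (X 0 ^ (m + 1) * X 1 ^ (m + 1 + 2)) : MvPolynomial (Fin 3) K) = X 0 ^ (m + 2) * X 1 ^ (m + 3) * X 2 ^ 0 := by ring
      rw [e]
      exact SecondOrderPoint.monomial_mem_pow₃ K (m + 2) (m + 3) 0 (by omega)
    have htr₀ : aeval (fun i : Fin 3 => X i + C ((0 : Fin 3 → K) i)) (X 0 * X 1 + X 2 ^ 2 + X 0 * (X 0 ^ (m + 1) * X 1 ^ (m + 1 + 2)) : MvPolynomial (Fin 3) K) =
        (X 0 * X 1 + X 2 ^ 2) + (0 + X 0 * (X 0 ^ (m + 1) * X 1 ^ (m + 1 + 2))) := by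
      rw [SecondOrderPoint.aeval_translate_zero]; ring
    have htr₁ : aeval (fun i : Fin 3 => X i + C ((0 : Fin 3 → K) i)) (X 2 ^ 2 + X 1 * (X 0 ^ 2 + X 0 * X 1 ^ (m + 1)) : MvPolynomial (Fin 3) K) =
        X 2 ^ 2 + (X 0 ^ 2 * X 1 + X 0 * X 1 ^ (m + 2)) := by
      rw [SecondOrderPoint.aeval_translate_zero]; ring
    refine towerLevel_succ_origin_marked K D hD0 hDsucc (m + 1) (X 2 ^ 2) (X 0 ^ 2 * X 1 + X 0 * X 1 ^ (m + 3)) (by norm_num) hΦ hΦ0 hΨ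
      ![X 0 * X 1 + X 2 ^ 2 + X 0 * (X 0 ^ (m + 1) * X 1 ^ (m + 1 + 2)), X 2 ^ 2 + X 1 * (X 0 ^ 2 + X 0 * X 1 ^ (m + 1)), G₂] (fun a => ?_)
      ![{(0 : Fin 3 → K)}, {(0 : Fin 3 → K)}, ∅] (fun a P hP haP hGP => ?_) (fun a lam hlam _ => ?_) y₀ hy₀
    · fin_cases a
      · exact hG₀
      · exact hG₁
      · exact hG₂
    · fin_cases a
      · by_cases hall : ∀ j, pderiv j (X 0 * X 1 + X 2 ^ 2 + X 0 * (X 0 ^ (m + 1) * X 1 ^ (m + 1 + 2)) : MvPolynomial (Fin 3) K) ∈ P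
        · right
          obtain ⟨h2, hj⟩ := SecondOrderPoint.D_even_jac₀ K (m + 1) P hP haP hGP hall
          have h1 : (X 1 : MvPolynomial (Fin 3) K) ∈ P := by
            have e : (X 1 : MvPolynomial (Fin 3) K) = X 1 * (1 + X 0 ^ (m + 1) * X 1 ^ (m + 1 + 1)) - X 0 * (X 0 ^ m * X 1 ^ (m + 3)) := by ring
            rw [e]
            exact P.sub_mem hj (P.mul_mem_right _ haP)
          exact ⟨0, Finset.mem_singleton_self _, SecondOrderPoint.forall_X_sub_C_zero_mem K P haP h1 h2⟩
        · left
          push Not at hall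
          exact hall
      · by_cases hall : ∀ j, pderiv j (X 2 ^ 2 + X 1 * (X 0 ^ 2 + X 0 * X 1 ^ (m + 1)) : MvPolynomial (Fin 3) K) ∈ P
        · right
          obtain ⟨h2, hj⟩ := SecondOrderPoint.D_even_jac₁ K m P hP haP hGP hall
          have h0 : (X 0 : MvPolynomial (Fin 3) K) ∈ P := by
            refine hP.mem_of_pow_mem 2 ?_
            have e : (X 0 ^ 2 : MvPolynomial (Fin 3) K) = X 0 * (X 0 + X 1 ^ (m + 1)) - X 1 * (X 0 * X 1 ^ m) := by ring
            rw [e]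
            exact P.sub_mem hj (P.mul_mem_right _ haP)
          exact ⟨0, Finset.mem_singleton_self _, SecondOrderPoint.forall_X_sub_C_zero_mem K P h0 haP h2⟩
        · left
          push Not at hall
          exact hall
      · exact (hJ₂ P hP haP hGP).elim
    · fin_cases a
      · -- chart 0: the node at the origin, level 0
        have hlam0 : lam = 0 := by simpa using hlam
        subst hlam0
        refine ⟨2, X 0 * X 1 + X 2 ^ 2, 0 + X 0 * (X 0 ^ (m + 1) * X 1 ^ (m + 1 + 2)), by norm_num, hnode,
          FirstOrderPoint.add_mem_pow_succ K (isHomogeneous_zero _ _ _) htail₀, htr₀, fun y' hy' => ⟨0, by omega, ?_⟩⟩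
        exact towerLevel_zero_origin K D hD0 hDsucc (X 0 * X 1 + X 2 ^ 2) (0 + X 0 * (X 0 ^ (m + 1) * X 1 ^ (m + 1 + 2))) (by norm_num)
          hnode hnode0 (FirstOrderPoint.add_mem_pow_succ K (isHomogeneous_zero _ _ _) htail₀) (hnode1 0 _ (isHomogeneous_zero _ _ _) htail₀) y' hy'
      · -- chart 1: `f_m` at the origin, level `m + 1` by induction
        have hlam0 : lam = 0 := by simpa using hlam
        subst hlam0
        exact ⟨2, X 2 ^ 2, X 0 ^ 2 * X 1 + X 0 * X 1 ^ (m + 2), by norm_num, hΦ, SecondOrderPoint.D_even_tail_mem_pow K m, htr₁,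
          fun y' hy' => ⟨m + 1, le_rfl, ih (X 2 ^ 2 + (X 0 ^ 2 * X 1 + X 0 * X 1 ^ (m + 2))) (by ring) y' hy'⟩⟩
      · exact absurd hlam (Finset.notMem_empty _)

end OneStep

end Summit.ResolutionOfSingularities.ResolutionOfSingularities.Cruxes.EquisingularLiftNat.Sections

end
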